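import Literature.Analysis.FluidPDE.PassiveVectorGalerkinEnergy
import Literature.Analysis.FunctionSpaces.TorusSpectralWeakDerivative
import HarnessLib

/-!
# Weak passive-vector solutions with bounded carrier have finite dissipation (`L²_t H¹_x`)

Analysis/FluidPDE proof-support file (everything proved; no new definitions). Third brick of the
vector Fourier–Galerkin energy argument for `Torus.IsWeakPassiveVectorOn A T ν b w₀ w`
(`∂ₜw + (b·∇)w + A (w·∇)b + ∇π = νΔw`, `∇·w = 0`; Yoshida–Kaneda 2000, (4)–(5)): the modewise
dissipation bounds `PassiveVectorGalerkinEnergy.ae_sq_norm_add_dissipation_le` are summed over all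
frequencies (Plancherel for vector fields, Tonelli, `Torus.eGradNormSq_eq_tsum`):

* `IsWeakPassiveVectorOn.ae_lintegral_sq_add_eVectorDissipation_le` — for `ν > 0`, a carrier bounded by
  `M` a.e. on `(0,T) × T^d` and a datum `w₀ ∈ L²` weakly divergence free: for a.e. `t ∈ (0,T)`,
  `∫⁻ ‖w(t)‖ₑ² + ν ∫⁻_{(0,t)} ‖∇w(s)‖²_{L²} ds ≤ ∫⁻ ‖w₀‖ₑ² + (2d(1+A²)M²/ν) ∫⁻_{(0,t)} ∫⁻ ‖w(s)‖ₑ² ds`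
  in `ℝ≥0∞`, with `ν ∫⁻_{(0,t)} ‖∇w‖² = eVectorDissipation ν w 0 t`
  (Robinson–Rodrigo–Sadowski 2016, (4.20), for the weak solution itself);
* `IsWeakPassiveVectorOn.ae_eVectorDissipation_lt_top` / `eVectorDissipation_lt_top` — hence **every weak
  solution with bounded carrier (`stLift b ∈ L^∞`) is in `L²_t H¹_x`**: `eVectorDissipation ν w 0 t < ∞`
  for a.e. `t ∈ (0,T)` and for `t = T` (the partial dissipations exhaust `(0,T)`).

So the «finite-dissipation» proviso of the lower energy inequality (cell `ad-ideate`, LIT-PACK §38a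
V2) is automatic for bounded carriers; together with the energy identity of the modes this is the
input of the energy EQUALITY (Galerkin remainder `→ 0`, LIT-PACK §40b (5)).

## Mathlib / tree search

Tree: `PassiveVectorGalerkinEnergy`, `PassiveVectorUniqueness` (`ae_tsum_enorm_sq_mFourierCoeff_products_le`),
`TorusVectorParseval.tsum_enorm_sq_mFourierCoeff_complexify`, `TorusSpectralWeakDerivative.eGradNormSq_eq_tsum`,
`PassiveVector.eVectorDissipation`.

## References

* J. C. Robinson, J. L. Rodrigo, W. Sadowski, *The three-dimensional Navier–Stokes equations*
  (CUP 2016), §4.2 (4.20). [`RobinsonRodrigoSadowski2016`]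
* K. Yoshida, Y. Kaneda, Phys. Rev. E 63 (2000) 016308, §II eq. (4)–(5). [`YoshidaKaneda2000`]
-/

noncomputable section

open MeasureTheory Set Filter Function TopologicalSpace Complex UnitAddTorus
open scoped ENNReal NNReal InnerProductSpace ComplexConjugate

namespace Literature.Analysis.FluidPDE

namespace Torus

variable {d : Type*} [Fintype d] [DecidableEq d]

namespace IsWeakPassiveVectorOn

variable {A T ν : ℝ} {b w : ℝ → UnitAddTorus d → EuclideanSpace ℝ d} {w₀ : UnitAddTorus d → EuclideanSpace ℝ d}

/-- The Fourier modes of a weak solution are essentially bounded: `‖ŵ(τ)(k)‖ ≤ sup ‖w‖₂` for a.e. `τ`.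
[cite: RobinsonRodrigoSadowski2016, §4.2 (Galerkin energy estimate)] -/
theorem exists_ae_norm_mFourierCoeff_le (h : IsWeakPassiveVectorOn A T ν b w₀ w) (k : d → ℤ) :
    ∃ K : ℝ, ∀ᵐ τ ∂(volume.restrict (Ioo 0 T)),
      ‖mFourierCoeff (FunctionSpaces.EuclideanSpace.complexify ∘ w τ) k‖ ≤ K := by
  obtain ⟨C₁, hC₁⟩ := h.exists_eLpNorm_le
  refine ⟨C₁, ?_⟩
  filter_upwards [hC₁, h.ae_memLp_two] with τ hτ hm
  have h1 : ‖mFourierCoeff (FunctionSpaces.EuclideanSpace.complexify ∘ w τ) k‖ ≤ ∫ x, ‖w τ x‖ := by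
    rw [FunctionSpaces.Torus.mFourierCoeff_eq_integral_volume]
    have hint : Integrable (fun x => mFourier (-k) x • (FunctionSpaces.EuclideanSpace.complexify ∘ w τ) x) volume :=
      FunctionSpaces.Torus.integrable_mFourier_smul'
        (FunctionSpaces.Torus.integrable_complexify_comp (hm.integrable one_le_two)) k
    refine (norm_integral_le_integral_norm _).trans (integral_mono hint.norm (hm.integrable one_le_two).norm fun x => ?_)
    dsimp only
    rw [norm_smul, Function.comp_apply, FunctionSpaces.EuclideanSpace.norm_complexify]
    exact mul_le_of_le_one_left (norm_nonneg _) (((mFourier (-k)).norm_coe_le_norm x).trans_eq mFourier_norm)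
  have h2 : ∫ x, ‖w τ x‖ ≤ C₁ := by
    have e1 : ENNReal.ofReal (∫ x, ‖w τ x‖) = eLpNorm (w τ) 1 volume := by
      rw [eLpNorm_one_eq_lintegral_enorm, ← ofReal_integral_norm_eq_lintegral_enorm (hm.integrable one_le_two)]
    have e2 : ENNReal.ofReal (∫ x, ‖w τ x‖) ≤ C₁ :=
      e1.le.trans ((eLpNorm_le_eLpNorm_of_exponent_le (by norm_num) hm.1).trans hτ)
    have := (ENNReal.ofReal_le_iff_le_toReal ENNReal.coe_ne_top).1 e2
    simpa using this
  exact h1.trans h2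

/-- `τ ↦ ‖ŵ(τ)(k)‖²` is integrable on `(0,T)`. [cite: RobinsonRodrigoSadowski2016, §4.2 (Galerkin energy estimate)] -/
theorem integrableOn_norm_sq_mFourierCoeff (h : IsWeakPassiveVectorOn A T ν b w₀ w) (k : d → ℤ) :
    IntegrableOn (fun τ => ‖mFourierCoeff (FunctionSpaces.EuclideanSpace.complexify ∘ w τ) k‖ ^ 2) (Ioo 0 T) volume := by
  obtain ⟨K, hK⟩ := h.exists_ae_norm_mFourierCoeff_le k
  refine IntegrableOn.of_bound measure_Ioo_lt_top ((h.integrableOn_mFourierCoeff k).aestronglyMeasurable.norm.pow 2)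
    (K ^ 2) ?_
  filter_upwards [hK] with τ hτ
  rw [Real.norm_eq_abs, abs_of_nonneg (sq_nonneg _)]
  exact pow_le_pow_left₀ (norm_nonneg _) hτ 2

/-- Plancherel bound for the flux energies summed over all frequencies:
`∑ₖ γ_k(τ) ≤ 2 d M² ∫⁻ ‖w(τ)‖ₑ²` for a.e. `τ` (`γ_k = ∑ⱼ ‖𝓕(bⱼw)(k)‖ₑ² + ‖𝓕(wⱼb)(k)‖ₑ²`, carrier
bounded by `M`). [cite: RobinsonRodrigoSadowski2016, §4.2 (Galerkin energy estimate)] -/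
theorem ae_tsum_fluxEnergy_le (h : IsWeakPassiveVectorOn A T ν b w₀ w) {M : ℝ} (hM : 0 ≤ M)
    (hbM : ∀ᵐ q ∂(((volume : Measure ℝ).restrict (Ioo 0 T)).prod (volume : Measure (UnitAddTorus d))),
      ‖b q.1 q.2‖ ≤ M) :
    ∀ᵐ τ ∂(volume.restrict (Ioo 0 T)),
      ∑' k : d → ℤ, ∑ j,
        (‖mFourierCoeff (FunctionSpaces.EuclideanSpace.complexify ∘ fun x => b τ x j • w τ x) k‖ₑ ^ 2 +
          ‖mFourierCoeff (FunctionSpaces.EuclideanSpace.complexify ∘ fun x => w τ x j • b τ x) k‖ₑ ^ 2) ≤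
        (Fintype.card d : ℝ≥0∞) * (2 * (ENNReal.ofReal (M ^ 2) * ∫⁻ x, ‖w τ x‖ₑ ^ 2)) := by
  filter_upwards [h.ae_tsum_enorm_sq_mFourierCoeff_products_le hM hbM] with τ hτ
  rw [Summable.tsum_finsetSum (fun _ _ => ENNReal.summable)]
  calc ∑ j, ∑' k : d → ℤ,
        (‖mFourierCoeff (FunctionSpaces.EuclideanSpace.complexify ∘ fun x => b τ x j • w τ x) k‖ₑ ^ 2 +
          ‖mFourierCoeff (FunctionSpaces.EuclideanSpace.complexify ∘ fun x => w τ x j • b τ x) k‖ₑ ^ 2)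
      ≤ ∑ _j : d, 2 * (ENNReal.ofReal (M ^ 2) * ∫⁻ x, ‖w τ x‖ₑ ^ 2) := by
        refine Finset.sum_le_sum fun j _ => ?_
        rw [ENNReal.tsum_add, two_mul]
        exact add_le_add (hτ.2 j).1 (hτ.2 j).2
    _ = (Fintype.card d : ℝ≥0∞) * (2 * (ENNReal.ofReal (M ^ 2) * ∫⁻ x, ‖w τ x‖ₑ ^ 2)) := by
        rw [Finset.sum_const, Finset.card_univ, nsmul_eq_mul]

/-- **Energy-type bound with dissipation, `ℝ≥0∞` form.** For `ν > 0`, a carrier bounded by `M` a.e.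
on `(0,T) × T^d` and a datum `w₀ ∈ L²` weakly divergence free: for a.e. `t ∈ (0,T)`,
`∫⁻ ‖w(t)‖ₑ² + ν ∫⁻_{(0,t)} ‖∇w(s)‖² ds ≤ ∫⁻ ‖w₀‖ₑ² + (2d(1+A²)M²/ν) ∫⁻_{(0,t)} ∫⁻ ‖w(s)‖ₑ² ds`
(`eVectorDissipation ν w 0 t = ν ∫⁻_{(0,t)} eGradNormSq (w s)`; sum of the modewise dissipation bounds,
Plancherel and Tonelli; Robinson–Rodrigo–Sadowski 2016, (4.20)). [cite: RobinsonRodrigoSadowski2016, §4.2 (4.20)] -/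
theorem ae_lintegral_sq_add_eVectorDissipation_le (h : IsWeakPassiveVectorOn A T ν b w₀ w) (hν : 0 < ν)
    (hw₀ : MemLp w₀ 2 volume) (hdiv₀ : FunctionSpaces.Torus.IsWeaklyDivFree w₀) {M : ℝ} (hM : 0 ≤ M)
    (hbM : ∀ᵐ q ∂(((volume : Measure ℝ).restrict (Ioo 0 T)).prod (volume : Measure (UnitAddTorus d))),
      ‖b q.1 q.2‖ ≤ M) :
    ∀ᵐ t ∂(volume.restrict (Ioo 0 T)),
      (∫⁻ x, ‖w t x‖ₑ ^ 2) + eVectorDissipation ν w 0 t ≤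
        (∫⁻ x, ‖w₀ x‖ₑ ^ 2) +
          ENNReal.ofReal ((1 + A ^ 2) / ν) * ((Fintype.card d : ℝ≥0∞) * (2 * ENNReal.ofReal (M ^ 2))) *
            ∫⁻ s in Ioo 0 t, ∫⁻ x, ‖w s x‖ₑ ^ 2 := by
  -- names
  set Φ : ℝ → ℝ≥0∞ := fun t => ∫⁻ x, ‖w t x‖ₑ ^ 2 with hΦ
  set X : (d → ℤ) → ℝ → EuclideanSpace ℂ d := fun k t =>
    mFourierCoeff (FunctionSpaces.EuclideanSpace.complexify ∘ w t) k with hX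
  set X₀ : (d → ℤ) → EuclideanSpace ℂ d := fun k =>
    mFourierCoeff (FunctionSpaces.EuclideanSpace.complexify ∘ w₀) k with hX₀
  set γ : (d → ℤ) → ℝ → ℝ := fun k τ => ∑ j,
    (‖mFourierCoeff (FunctionSpaces.EuclideanSpace.complexify ∘ fun x => b τ x j • w τ x) k‖ ^ 2 +
      ‖mFourierCoeff (FunctionSpaces.EuclideanSpace.complexify ∘ fun x => w τ x j • b τ x) k‖ ^ 2) with hγ
  set c : ℝ := (1 + A ^ 2) / ν with hc
  have hc0 : 0 ≤ c := by positivity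
  have hγi : ∀ k, IntegrableOn (γ k) (Ioo 0 T) volume := fun k => h.integrableOn_fluxEnergy hM hbM k
  have hXi : ∀ k, IntegrableOn (fun τ => ‖X k τ‖ ^ 2) (Ioo 0 T) volume := fun k => h.integrableOn_norm_sq_mFourierCoeff k
  -- all modewise bounds at once
  have hmodes := ae_all_iff.2 fun k => h.ae_sq_norm_add_dissipation_le hν hw₀ hdiv₀ hM hbM k
  have hflux := h.ae_tsum_fluxEnergy_le hM hbM
  filter_upwards [hmodes, h.ae_memLp_two, ae_restrict_mem measurableSet_Ioo] with t ht hmt htT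
  have hsub : Ioc 0 t ⊆ Ioo 0 T := fun τ hτ => ⟨hτ.1, hτ.2.trans_lt htT.2⟩
  -- modewise, in `ℝ≥0∞`
  have hk : ∀ k, ‖X k t‖ₑ ^ 2 + ENNReal.ofReal (4 * Real.pi ^ 2 * ν * FunctionSpaces.Torus.freqNormSq k) *
      ∫⁻ τ in Ioc 0 t, ‖X k τ‖ₑ ^ 2 ≤
      ‖X₀ k‖ₑ ^ 2 + ENNReal.ofReal c * ∫⁻ τ in Ioc 0 t, ENNReal.ofReal (γ k τ) := by
    intro k
    have hN0 := FunctionSpaces.Torus.freqNormSq_nonneg k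
    have hν'0 : 0 ≤ 4 * Real.pi ^ 2 * ν * FunctionSpaces.Torus.freqNormSq k := by positivity
    have e1 : ∀ v : EuclideanSpace ℂ d, ‖v‖ₑ ^ 2 = ENNReal.ofReal (‖v‖ ^ 2) := fun v => by
      rw [← ofReal_norm, ENNReal.ofReal_pow (norm_nonneg _)]
    have e2 : ∫⁻ τ in Ioc 0 t, ‖X k τ‖ₑ ^ 2 = ENNReal.ofReal (∫ τ in Ioc 0 t, ‖X k τ‖ ^ 2) := by
      rw [ofReal_integral_eq_lintegral_ofReal ((hXi k).mono_set hsub) (ae_of_all _ fun τ => sq_nonneg _)]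
      exact lintegral_congr fun τ => e1 _
    have e3 : ∫⁻ τ in Ioc 0 t, ENNReal.ofReal (γ k τ) = ENNReal.ofReal (∫ τ in Ioc 0 t, γ k τ) := by
      rw [ofReal_integral_eq_lintegral_ofReal ((hγi k).mono_set hsub)
        (ae_of_all _ fun τ => Finset.sum_nonneg fun j _ => by positivity)]
    have hI0 : 0 ≤ ∫ τ in Ioc 0 t, ‖X k τ‖ ^ 2 := setIntegral_nonneg measurableSet_Ioc fun τ _ => sq_nonneg _
    have hJ0 : 0 ≤ ∫ τ in Ioc 0 t, γ k τ :=
      setIntegral_nonneg measurableSet_Ioc fun τ _ => Finset.sum_nonneg fun j _ => by positivity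
    rw [e1, e1, e2, e3, ← ENNReal.ofReal_mul hν'0, ← ENNReal.ofReal_mul hc0, ← ENNReal.ofReal_add (sq_nonneg _)
      (mul_nonneg hν'0 hI0), ← ENNReal.ofReal_add (sq_nonneg _) (mul_nonneg hc0 hJ0)]
    exact ENNReal.ofReal_le_ofReal (ht k)
  -- sum over `k`
  have hsum : (∑' k, ‖X k t‖ₑ ^ 2) + ∑' k, ENNReal.ofReal (4 * Real.pi ^ 2 * ν * FunctionSpaces.Torus.freqNormSq k) *
      ∫⁻ τ in Ioc 0 t, ‖X k τ‖ₑ ^ 2 ≤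
      (∑' k, ‖X₀ k‖ₑ ^ 2) + ∑' k, ENNReal.ofReal c * ∫⁻ τ in Ioc 0 t, ENNReal.ofReal (γ k τ) := by
    rw [← ENNReal.tsum_add, ← ENNReal.tsum_add]
    exact ENNReal.tsum_le_tsum hk
  -- identify the four sums
  have hP : ∑' k, ‖X k t‖ₑ ^ 2 = Φ t := FunctionSpaces.Torus.tsum_enorm_sq_mFourierCoeff_complexify hmt
  have hP₀ : ∑' k, ‖X₀ k‖ₑ ^ 2 = ∫⁻ x, ‖w₀ x‖ₑ ^ 2 := FunctionSpaces.Torus.tsum_enorm_sq_mFourierCoeff_complexify hw₀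
  have hmeasX : ∀ k, AEMeasurable (fun τ => ENNReal.ofReal (FunctionSpaces.Torus.freqNormSq k) * ‖X k τ‖ₑ ^ 2)
      (volume.restrict (Ioc 0 t)) := fun k =>
    (((h.integrableOn_mFourierCoeff k).aestronglyMeasurable.aemeasurable.mono_set hsub).enorm.pow_const 2).const_mul _
  have hD : ∑' k, ENNReal.ofReal (4 * Real.pi ^ 2 * ν * FunctionSpaces.Torus.freqNormSq k) *
      ∫⁻ τ in Ioc 0 t, ‖X k τ‖ₑ ^ 2 = eVectorDissipation ν w 0 t := by
    have e : ∀ k, ENNReal.ofReal (4 * Real.pi ^ 2 * ν * FunctionSpaces.Torus.freqNormSq k) *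
        ∫⁻ τ in Ioc 0 t, ‖X k τ‖ₑ ^ 2 =
        ENNReal.ofReal ν * (ENNReal.ofReal (4 * Real.pi ^ 2) *
          ∫⁻ τ in Ioc 0 t, ENNReal.ofReal (FunctionSpaces.Torus.freqNormSq k) * ‖X k τ‖ₑ ^ 2) := by
      intro k
      rw [lintegral_const_mul' _ _ ENNReal.ofReal_ne_top, ← mul_assoc, ← mul_assoc, ← ENNReal.ofReal_mul hν.le,
        ← ENNReal.ofReal_mul (by positivity)]
      congr 2
      ring
    simp_rw [e]
    rw [ENNReal.tsum_mul_left, ENNReal.tsum_mul_left, ← lintegral_tsum hmeasX, eVectorDissipation,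
      ← lintegral_const_mul' _ _ ENNReal.ofReal_ne_top,
      setLIntegral_congr (Ioo_ae_eq_Ioc (μ := (volume : Measure ℝ)))]
    congr 1
    refine lintegral_congr fun τ => ?_
    rw [FunctionSpaces.Torus.eGradNormSq_eq_tsum]
  have hmeasγ : ∀ k, AEMeasurable (fun τ => ENNReal.ofReal (γ k τ)) (volume.restrict (Ioc 0 t)) := fun k =>
    ((hγi k).aestronglyMeasurable.aemeasurable.mono_set hsub).ennreal_ofReal
  have hR : ∑' k, ENNReal.ofReal c * ∫⁻ τ in Ioc 0 t, ENNReal.ofReal (γ k τ) ≤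
      ENNReal.ofReal c * ((Fintype.card d : ℝ≥0∞) * (2 * ENNReal.ofReal (M ^ 2))) * ∫⁻ s in Ioo 0 t, Φ s := by
    rw [ENNReal.tsum_mul_left, ← lintegral_tsum hmeasγ, mul_assoc]
    gcongr 1
    have eγ : ∀ τ, ∑' k, ENNReal.ofReal (γ k τ) = ∑' k : d → ℤ, ∑ j,
        (‖mFourierCoeff (FunctionSpaces.EuclideanSpace.complexify ∘ fun x => b τ x j • w τ x) k‖ₑ ^ 2 +
          ‖mFourierCoeff (FunctionSpaces.EuclideanSpace.complexify ∘ fun x => w τ x j • b τ x) k‖ₑ ^ 2) := by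
      intro τ
      refine tsum_congr fun k => ?_
      rw [hγ]
      simp only
      rw [ENNReal.ofReal_sum_of_nonneg (fun j _ => by positivity)]
      refine Finset.sum_congr rfl fun j _ => ?_
      rw [ENNReal.ofReal_add (sq_nonneg _) (sq_nonneg _), ← ofReal_norm, ENNReal.ofReal_pow (norm_nonneg _),
        ← ofReal_norm, ENNReal.ofReal_pow (norm_nonneg _)]
    calc ∫⁻ τ in Ioc 0 t, ∑' k, ENNReal.ofReal (γ k τ)
        ≤ ∫⁻ τ in Ioc 0 t, (Fintype.card d : ℝ≥0∞) * (2 * (ENNReal.ofReal (M ^ 2) * Φ τ)) := by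
          refine lintegral_mono_ae ?_
          filter_upwards [ae_restrict_of_ae_restrict_of_subset hsub hflux] with τ hτ
          rw [eγ]
          exact hτ
      _ = ((Fintype.card d : ℝ≥0∞) * (2 * ENNReal.ofReal (M ^ 2))) * ∫⁻ s in Ioo 0 t, Φ s := by
          rw [lintegral_const_mul' _ _ (ENNReal.natCast_ne_top _), lintegral_const_mul' _ _ ENNReal.ofNat_ne_top,
            lintegral_const_mul' _ _ ENNReal.ofReal_ne_top,
            setLIntegral_congr (Ioo_ae_eq_Ioc (μ := (volume : Measure ℝ)))]
          ring
  rw [hP, hP₀, hD] at hsum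
  exact hsum.trans (add_le_add le_rfl hR)

omit [DecidableEq d] in
/-- An `L^∞` bound on the space–time lift is an a.e. bound on `(0,T) × T^d`. [folklore] -/
private theorem ae_norm_le_prod_of_memLp_top_stLift₃ {u : ℝ → UnitAddTorus d → EuclideanSpace ℝ d} {T : ℝ}
    (hu : MemLp (FunctionSpaces.Torus.stLift u) ∞ (volume.restrict (Ioo 0 T ×ˢ univ))) :
    ∃ M : ℝ, 0 ≤ M ∧ ∀ᵐ q ∂(((volume : Measure ℝ).restrict (Ioo 0 T)).prod (volume : Measure (UnitAddTorus d))),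
      ‖u q.1 q.2‖ ≤ M := by
  set μ' : Measure (ℝ × EuclideanSpace ℝ d) := volume.restrict (Ioo 0 T ×ˢ univ) with hμ'
  set M : ℝ := (eLpNorm (FunctionSpaces.Torus.stLift u) ∞ μ').toReal with hM
  have hfin : eLpNorm (FunctionSpaces.Torus.stLift u) ∞ μ' < (⊤ : ℝ≥0∞) := hu.eLpNorm_lt_top
  have hae' : ∀ᵐ p ∂μ', ‖FunctionSpaces.Torus.stLift u p‖ ≤ M := by
    filter_upwards [ae_le_eLpNormEssSup (f := FunctionSpaces.Torus.stLift u) (μ := μ')] with p hp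
    rw [← eLpNorm_exponent_top] at hp
    have := ENNReal.toReal_mono hfin.ne hp
    rwa [toReal_enorm] at this
  refine ⟨M, ENNReal.toReal_nonneg, ?_⟩
  have hprod : μ' = ((volume : Measure ℝ).restrict (Ioo 0 T)).prod volume := by
    rw [hμ', Measure.volume_eq_prod, ← Measure.prod_restrict, Measure.restrict_univ]
  rw [hprod] at hae'
  have hq := MeasureTheory.QuasiMeasurePreserving.prodMap
    (Measure.QuasiMeasurePreserving.id ((volume : Measure ℝ).restrict (Ioo 0 T)))
    (FunctionSpaces.Torus.quasiMeasurePreserving_repr (d := d))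
  filter_upwards [hq.ae hae'] with q hq'
  simpa [FunctionSpaces.Torus.stLift] using hq'

/-- **Weak passive-vector solutions with bounded carrier are in `L²_t H¹_x`.** For `ν > 0`,
`stLift b ∈ L^∞((0,T) × T^d)` and a datum `w₀ ∈ L²` weakly divergence free, every weak solution has
finite dissipation on `(0,t)` for a.e. `t ∈ (0,T)`: `eVectorDissipation ν w 0 t < ∞`.
[cite: RobinsonRodrigoSadowski2016, §4.2 (4.20)] -/
theorem ae_eVectorDissipation_lt_top (h : IsWeakPassiveVectorOn A T ν b w₀ w) (hν : 0 < ν)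
    (hw₀ : MemLp w₀ 2 volume) (hdiv₀ : FunctionSpaces.Torus.IsWeaklyDivFree w₀)
    (hb : MemLp (FunctionSpaces.Torus.stLift b) ∞ (volume.restrict (Ioo 0 T ×ˢ univ))) :
    ∀ᵐ t ∂(volume.restrict (Ioo 0 T)), eVectorDissipation ν w 0 t < ⊤ := by
  obtain ⟨M, hM, hbM⟩ := ae_norm_le_prod_of_memLp_top_stLift₃ hb
  obtain ⟨C, hC⟩ := h.ae_lintegral_sq_le
  have hC' : ∀ᵐ τ ∂(volume : Measure ℝ), τ ∈ Ioo 0 T → ∫⁻ x, ‖w τ x‖ₑ ^ 2 ≤ C :=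
    (ae_restrict_iff' measurableSet_Ioo).1 hC
  have hw₀' : ∫⁻ x, ‖w₀ x‖ₑ ^ 2 < ⊤ := by
    have hint : Integrable (fun x => ‖w₀ x‖ ^ 2) volume := (memLp_two_iff_integrable_sq_norm hw₀.1).1 hw₀
    have e : ∫⁻ x, ‖w₀ x‖ₑ ^ 2 = ∫⁻ x, ‖(‖w₀ x‖ ^ 2 : ℝ)‖ₑ := by
      refine lintegral_congr fun x => ?_
      rw [Real.enorm_eq_ofReal (sq_nonneg _), ← ofReal_norm, ENNReal.ofReal_pow (norm_nonneg _)]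
    rw [e]
    exact hint.2
  set L : ℝ≥0∞ := ENNReal.ofReal ((1 + A ^ 2) / ν) * ((Fintype.card d : ℝ≥0∞) * (2 * ENNReal.ofReal (M ^ 2))) with hL
  have hLtop : L ≠ ⊤ :=
    ENNReal.mul_ne_top ENNReal.ofReal_ne_top
      (ENNReal.mul_ne_top (ENNReal.natCast_ne_top _) (ENNReal.mul_ne_top ENNReal.ofNat_ne_top ENNReal.ofReal_ne_top))
  filter_upwards [h.ae_lintegral_sq_add_eVectorDissipation_le hν hw₀ hdiv₀ hM hbM, ae_restrict_mem measurableSet_Ioo]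
    with t ht htT
  have hint : ∫⁻ s in Ioo 0 t, ∫⁻ x, ‖w s x‖ₑ ^ 2 ≤ (C : ℝ≥0∞) * volume (Ioo (0 : ℝ) t) := by
    rw [← setLIntegral_const]
    refine lintegral_mono_ae ((ae_restrict_iff' measurableSet_Ioo).2 (hC'.mono fun τ hτ hτt => ?_))
    exact hτ ⟨hτt.1, hτt.2.trans htT.2⟩
  have hfin : (∫⁻ x, ‖w₀ x‖ₑ ^ 2) + L * ∫⁻ s in Ioo 0 t, ∫⁻ x, ‖w s x‖ₑ ^ 2 < ⊤ :=
    ENNReal.add_lt_top.2 ⟨hw₀', ENNReal.mul_lt_top hLtop.lt_top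
      (lt_of_le_of_lt hint (ENNReal.mul_lt_top ENNReal.coe_lt_top measure_Ioo_lt_top))⟩
  exact lt_of_le_of_lt (le_add_self.trans ht) hfin

omit [Fintype d] [DecidableEq d] in
/-- From an a.e.-in-`t` bound on the partial integrals to the full one: if `∫⁻_{(0,t)} g ≤ K` for
a.e. `t ∈ (0,T)`, then `∫⁻_{(0,T)} g ≤ K` (`(0,T)` is the increasing union of the `(0, T - T/(n+2))`,
each dominated by a good `t`). [folklore] -/
private theorem setLIntegral_Ioo_le_of_ae_le {T : ℝ} {g : ℝ → ℝ≥0∞} {K : ℝ≥0∞}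
    (hae : ∀ᵐ t ∂(volume.restrict (Ioo 0 T)), ∫⁻ s in Ioo 0 t, g s ≤ K) :
    ∫⁻ s in Ioo 0 T, g s ≤ K := by
  rcases le_or_gt T 0 with hT | hT
  · rw [Ioo_eq_empty_of_le hT, Measure.restrict_empty, lintegral_zero_measure]
    exact bot_le
  -- the exhausting sequence `tₙ = T - T/(n+2)`
  set u : ℕ → ℝ := fun n => T - T / (n + 2) with hu
  have hu_lt : ∀ n, u n < T := fun n => by
    have : 0 < T / (n + 2) := by positivity
    simp only [hu]; linarith
  have hu_pos : ∀ n, 0 < u n := fun n => by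
    simp only [hu]
    have h2 : (2 : ℝ) ≤ n + 2 := by
      have := (Nat.cast_nonneg n : (0 : ℝ) ≤ n); linarith
    have : T / (n + 2) ≤ T / 2 := div_le_div_of_nonneg_left hT.le (by norm_num) h2
    linarith
  have hmono : Monotone fun n => Ioo (0 : ℝ) (u n) := by
    intro m n hmn
    refine Ioo_subset_Ioo le_rfl ?_
    simp only [hu]
    have h1 : (0 : ℝ) < m + 2 := by positivity
    have h2 : (m : ℝ) + 2 ≤ n + 2 := by exact_mod_cast Nat.add_le_add_right hmn 2
    have : T / (n + 2) ≤ T / (m + 2) := div_le_div_of_nonneg_left hT.le h1 h2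
    linarith
  have hunion : (⋃ n, Ioo (0 : ℝ) (u n)) = Ioo 0 T := by
    ext x
    simp only [mem_iUnion, mem_Ioo]
    constructor
    · rintro ⟨n, hx0, hxn⟩
      exact ⟨hx0, hxn.trans (hu_lt n)⟩
    · rintro ⟨hx0, hxT⟩
      obtain ⟨n, hn⟩ := exists_nat_gt (T / (T - x))
      refine ⟨n, hx0, ?_⟩
      simp only [hu]
      have hTx : 0 < T - x := by linarith
      have h1 : T / (n + 2) < T - x := by
        rw [div_lt_iff₀ (by positivity)]
        have := (div_lt_iff₀ hTx).1 hn
        nlinarith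
      linarith
  -- each partial integral is dominated by a good time in `(uₙ, T)`
  have hbound : ∀ n, ∫⁻ s in Ioo 0 (u n), g s ≤ K := by
    intro n
    have hsub : Ioo (u n) T ⊆ Ioo 0 T := Ioo_subset_Ioo (hu_pos n).le le_rfl
    have h' : ∀ᵐ t ∂(volume.restrict (Ioo (u n) T)), t ∈ Ioo (u n) T ∧ ∫⁻ s in Ioo 0 t, g s ≤ K :=
      (ae_restrict_mem measurableSet_Ioo).and (ae_restrict_of_ae_restrict_of_subset hsub hae)
    haveI : NeZero ((volume : Measure ℝ).restrict (Ioo (u n) T)) := ⟨by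
      rw [Ne, Measure.restrict_eq_zero, Real.volume_Ioo, ENNReal.ofReal_eq_zero, not_le]
      linarith [hu_lt n]⟩
    obtain ⟨t, ht, htK⟩ := h'.exists
    exact (lintegral_mono_set (Ioo_subset_Ioo le_rfl ht.1.le)).trans htK
  rw [← hunion, setLIntegral_iUnion_of_directed _ hmono.directed_le]
  exact iSup_le hbound

/-- **Finite total dissipation.** Under the hypotheses of `ae_eVectorDissipation_lt_top`, the
dissipation over the whole interval is finite: `eVectorDissipation ν w 0 T < ∞`, i.e.
`∫₀ᵀ ‖∇w‖²_{L²} < ∞` — every weak passive-vector solution with bounded carrier is in `L²(0,T; H¹)`.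
[cite: RobinsonRodrigoSadowski2016, §4.2 (4.20)] -/
theorem eVectorDissipation_lt_top (h : IsWeakPassiveVectorOn A T ν b w₀ w) (hν : 0 < ν)
    (hw₀ : MemLp w₀ 2 volume) (hdiv₀ : FunctionSpaces.Torus.IsWeaklyDivFree w₀)
    (hb : MemLp (FunctionSpaces.Torus.stLift b) ∞ (volume.restrict (Ioo 0 T ×ˢ univ))) :
    eVectorDissipation ν w 0 T < ⊤ := by
  obtain ⟨M, hM, hbM⟩ := ae_norm_le_prod_of_memLp_top_stLift₃ hb
  obtain ⟨C, hC⟩ := h.ae_lintegral_sq_le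
  have hC' : ∀ᵐ τ ∂(volume : Measure ℝ), τ ∈ Ioo 0 T → ∫⁻ x, ‖w τ x‖ₑ ^ 2 ≤ C :=
    (ae_restrict_iff' measurableSet_Ioo).1 hC
  have hw₀' : ∫⁻ x, ‖w₀ x‖ₑ ^ 2 < ⊤ := by
    have hint : Integrable (fun x => ‖w₀ x‖ ^ 2) volume := (memLp_two_iff_integrable_sq_norm hw₀.1).1 hw₀
    have e : ∫⁻ x, ‖w₀ x‖ₑ ^ 2 = ∫⁻ x, ‖(‖w₀ x‖ ^ 2 : ℝ)‖ₑ := by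
      refine lintegral_congr fun x => ?_
      rw [Real.enorm_eq_ofReal (sq_nonneg _), ← ofReal_norm, ENNReal.ofReal_pow (norm_nonneg _)]
    rw [e]
    exact hint.2
  set L : ℝ≥0∞ := ENNReal.ofReal ((1 + A ^ 2) / ν) * ((Fintype.card d : ℝ≥0∞) * (2 * ENNReal.ofReal (M ^ 2))) with hL
  have hLtop : L ≠ ⊤ :=
    ENNReal.mul_ne_top ENNReal.ofReal_ne_top
      (ENNReal.mul_ne_top (ENNReal.natCast_ne_top _) (ENNReal.mul_ne_top ENNReal.ofNat_ne_top ENNReal.ofReal_ne_top))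
  set K : ℝ≥0∞ := (∫⁻ x, ‖w₀ x‖ₑ ^ 2) + L * ((C : ℝ≥0∞) * volume (Ioo (0 : ℝ) T)) with hK
  have hKtop : K < ⊤ :=
    ENNReal.add_lt_top.2 ⟨hw₀', ENNReal.mul_lt_top hLtop.lt_top (ENNReal.mul_lt_top ENNReal.coe_lt_top measure_Ioo_lt_top)⟩
  -- a.e. bound on the partial dissipations
  have hae : ∀ᵐ t ∂(volume.restrict (Ioo 0 T)), ∫⁻ s in Ioo 0 t, ENNReal.ofReal ν * FunctionSpaces.Torus.eGradNormSq (w s) ≤ K := by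
    filter_upwards [h.ae_lintegral_sq_add_eVectorDissipation_le hν hw₀ hdiv₀ hM hbM, ae_restrict_mem measurableSet_Ioo]
      with t ht htT
    have hint : ∫⁻ s in Ioo 0 t, ∫⁻ x, ‖w s x‖ₑ ^ 2 ≤ (C : ℝ≥0∞) * volume (Ioo (0 : ℝ) T) := by
      calc ∫⁻ s in Ioo 0 t, ∫⁻ x, ‖w s x‖ₑ ^ 2 ≤ ∫⁻ _ in Ioo 0 t, (C : ℝ≥0∞) := by
            refine lintegral_mono_ae ((ae_restrict_iff' measurableSet_Ioo).2 (hC'.mono fun τ hτ hτt => ?_))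
            exact hτ ⟨hτt.1, hτt.2.trans htT.2⟩
        _ = (C : ℝ≥0∞) * volume (Ioo (0 : ℝ) t) := setLIntegral_const _ _
        _ ≤ (C : ℝ≥0∞) * volume (Ioo (0 : ℝ) T) := by
            gcongr
            exact htT.2.le
    rw [lintegral_const_mul' _ _ ENNReal.ofReal_ne_top]
    calc ENNReal.ofReal ν * ∫⁻ s in Ioo 0 t, FunctionSpaces.Torus.eGradNormSq (w s) = eVectorDissipation ν w 0 t := rfl
      _ ≤ (∫⁻ x, ‖w t x‖ₑ ^ 2) + eVectorDissipation ν w 0 t := le_add_self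
      _ ≤ (∫⁻ x, ‖w₀ x‖ₑ ^ 2) + L * ∫⁻ s in Ioo 0 t, ∫⁻ x, ‖w s x‖ₑ ^ 2 := ht
      _ ≤ K := by rw [hK]; gcongr
  have hle := setLIntegral_Ioo_le_of_ae_le hae
  rw [lintegral_const_mul' _ _ ENNReal.ofReal_ne_top] at hle
  exact lt_of_le_of_lt hle hKtop

end IsWeakPassiveVectorOn

end Torus

end Literature.Analysis.FluidPDE

end
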